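import Mathlib
import Literature.Probability.LatticeModels.SRWKilledWalkFunctionals
import Literature.Probability.RandomPlanarGeometry.ConformalRectangle
import HarnessLib

/-!
# GreenBoundaryFactorisation

Topic `Literature/Probability/LatticeModels`. Named literature fact(s) relocated by the gate from `Summits/CriticalPhenomena/SAWScalingLimit/Theorems/SAWExcursionCardyRWGreenCrossRatioLimit.lean`
(accept-time relocation of `[cite]`d propositions written inline in a Summits proposal; human ruling 2026-08-15).
Sources: KozdronLawler2005.

* `Literature.Probability.LatticeModels.KozdronLawler2005_greenBoundaryFactorisationLimit`
-/

namespace Literature.Probability.LatticeModels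

open Filter Topology
open Literature.Probability.LatticeModels Literature.Probability.RandomPlanarGeometry
open UpperHalfPlane (upperHalfPlaneSet)

/-- **Kozdron–Lawler 2005 — boundary factorisation of the Green function of the killed planar random
walk, scaling-limit form** (named fact, not proved in the tree).
M. J. Kozdron, G. F. Lawler, *Estimates of random walk exit probabilities and application to
loop-erased random walk*, Electron. J. Probab. 10 (2005) 1442–1467 (arXiv:math/0501189).
Setting of the source (§1.1, §2.3, §3.4): `A ∈ 𝒜ⁿ` a finite simply connected subset of `ℤ²` containing
`0` with inradius in `[n, 2n]`; `G_A(x,y)` the Green function of simple random walk killed on leaving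
`A`, and `G_A(x) = G_A(0,x)` (from the base point `0`); `f_A : Ã → 𝔻` the Riemann map of the
union-of-squares domain with `f_A(0) = 0`, `f_A'(0) > 0`; `θ_A(x) = arg f_A(x)`, `g_A = −log |f_A|`,
`A^{*,n} = {g_A ≥ n^{-1/16}}`. Proposition 3.10, second display: uniformly over `A ∈ 𝒜ⁿ`, for
`x, y ∈ A ∖ A^{*,n}` (points conformally close to `∂A`) with `|f_A(y) − e^{iθ_A(x)}| ≥ n^{-1/16} log² n`,
"`G_A(x,y) = (π/2) G_A(x) G_A(y) / (1 − cos(θ_A(x) − θ_A(y))) · [1 + O(n^{-1/16} log n / |θ_A(y) − θ_A(x)|)]`";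
Theorem 1.1 is the same factorisation for the excursion Poisson kernel `h_∂A(x,y)` with `h_A(0,·)`,
and Corollary 3.5 (`G_A = (2/π) g_A + k + O(n^{-7/24} log n)` on `A^{*,n}`) with the disc
computations (3.21)–(3.22) covers pairs at larger conformal depth. Content: the Green function
between two points near macroscopically distinct boundary points is a LOCAL factor at each point (its
Green function from the base point) times the conformally invariant excursion Poisson kernel of the
disc, `(1 − cos(θ − θ'))⁻¹`, with an error uniform over ALL simply connected lattice domains (no
boundary regularity). SCALING-LIMIT FORM STATED HERE (the form consumed by route `SAWExcursionCardy`
of `Summits/CriticalPhenomena/SAWScalingLimit`; cf. Kozdron, ALEA 2 (2006), §4.4, Cor. 4.13–4.15,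
where these estimates are restated on the `1/N`-scale discrete approximations `D_N` of a Jordan
domain, and Thm. 4.9 there: `D̃_N → D` in the Carathéodory sense): `Ω` a Jordan domain
(`JordanDomain`), `Ω_δ = discreteDomainGraph Ω δ` its lattice approximation (largest component of
`Ω ∩ δℤ²`, closed mesh edges inside `Ω̄`), `G = SRW.killedGreen (discreteDomainGraph Ω δ)` the Green
function of the walk run along `Ω_δ`-edges and killed at its first non-`Ω_δ` step (= the walk killed
on leaving the vertex set whenever all `ℤ²`-edges between vertices of `Ω_δ` are mesh edges), a base
point `o_δ` with `δ o_δ → o ∈ Ω`, and two families `p_δ, q_δ ∈ Ω_δ` with `δ p_δ → u`, `δ q_δ → v`,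
`u ≠ v ∈ ∂Ω` (at any rate: boundary vertices, or interior vertices at vanishing macroscopic distance
— the regimes of Prop. 3.10 and Cor. 3.5); the disc angles are written through a half-plane
uniformizer `ψ : ℍ → Ω` (`ConformalEquiv`) with `ψ(i) = o` and boundary values `ψ(s) = u`,
`ψ(t) = v`, `s ≠ t` real (`HasBoundaryValue`): under the Cayley map `z ↦ (z − i)/(z + i)` (sending
`i ↦ 0`), `1 − cos(θ(u) − θ(v)) = 2 (s − t)² / ((1 + s²)(1 + t²))`, and `θ_{Ω_δ}` at the lattice
points converges to `θ` of `Ω` at `u, v` (Carathéodory kernel convergence `Ω_δ → Ω` seen from `o`,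
Kozdron 2006 Thm. 4.9, with the boundary correspondence for the Jordan domain `Ω`, Pommerenke 1992,
Thm. 2.6 and §2.2–2.3). Conclusion:
`G(p_δ,q_δ) / (G(o_δ,p_δ) G(o_δ,q_δ)) → (π/4) (1 + s²)(1 + t²) / (s − t)²` as `δ → 0⁺`
(sanity check in the discrete half-plane, Kozdron–Lawler 2007 §5.1: `G_ℍ(j₁+i, j₂+i) ≈ 4/(π(j₁−j₂)²)`
and `G_ℍ(iN, j+i) ≈ 4N/(π(j²+N²))` give exactly this value with `s = j₁/N`, `t = j₂/N`).
TODO(general form): the finite-volume statement with its uniform error term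
`O(n^{-1/16} log n / |θ_A(x) − θ_A(y)|)` over `A ∈ 𝒜ⁿ` (Prop. 3.10), the excursion-kernel version
`h_∂A(x,y) = (π/2) h_A(0,x) h_A(0,y) / (1 − cos(θ_A(x) − θ_A(y))) [1 + O(…)]` (Thm. 1.1) and the
`k`-fold determinant form (Cor. 1.4).
[cite: KozdronLawler2005, Prop. 3.10 and Thm. 1.1] [file Probability/LatticeModels/GreenBoundaryFactorisation] -/
def KozdronLawler2005_greenBoundaryFactorisationLimit : Prop :=
  ∀ (D : JordanDomain) (ψ : ConformalEquiv upperHalfPlaneSet D.carrier) (s t : ℝ) (u v : ℂ),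
    s ≠ t → ψ.HasBoundaryValue s u → ψ.HasBoundaryValue t v →
    ∀ (p q o : ℝ → Site 2),
      Tendsto (fun δ => meshPoint δ (p δ)) (𝓝[>] 0) (𝓝 u) →
      Tendsto (fun δ => meshPoint δ (q δ)) (𝓝[>] 0) (𝓝 v) →
      Tendsto (fun δ => meshPoint δ (o δ)) (𝓝[>] 0) (𝓝 (ψ Complex.I)) →
      (∀ᶠ δ in 𝓝[>] 0, p δ ∈ meshDomain D.carrier δ ∧ q δ ∈ meshDomain D.carrier δ) →
      Tendsto (fun δ => SRW.killedGreen (discreteDomainGraph D.carrier δ) (p δ) (q δ) /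
          (SRW.killedGreen (discreteDomainGraph D.carrier δ) (o δ) (p δ) *
            SRW.killedGreen (discreteDomainGraph D.carrier δ) (o δ) (q δ)))
        (𝓝[>] 0) (𝓝 (Real.pi / 4 * ((1 + s ^ 2) * (1 + t ^ 2)) / (s - t) ^ 2))

/-! ### The limit constant against the global factor of Prop. 3.10

Status of the named fact above (literature-prover audit, 2026-08-16). What the cited source PROVES
is the finite-volume estimate of Kozdron–Lawler 2005, Prop. 3.10, eq. (41) (journal p. 1462) — for a
finite SIMPLY CONNECTED `A ⊂ ℤ²` with the walk killed on leaving the vertex set `A`, and with the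
conformal angle `θ_A` of the DISCRETE domain — and its excursion-kernel twin Thm. 1.1 (p. 1444); both
are vendored as printed in `ExcursionPoissonKernelAsymptotics.lean`
(`KozdronLawler_greenFunctionBoundary`, `KozdronLawler_excursionPoissonKernel`), where the global
factor `(π/2)/(1 − cos(θ_A(x) − θ_A(y)))` is written in the chord form `π/‖e_x − e_y‖²`,
`e = f_A/|f_A|`. The `δ → 0⁺` statement above additionally (i) replaces `θ_{A_δ}` at the lattice
points by the continuum angles of `Ω` through the half-plane uniformizer `ψ` (convergence of the
Riemann maps of the lattice domains up to the boundary — Kozdron 2006, Thm. 4.9, gives Carathéodory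
convergence on compacta only, and his Cor. 4.13–4.15 keep the discrete angle `θ_{D_N}`), and
(ii) runs the walk on `discreteDomainGraph Ω δ` (largest component, closed mesh edges in `Ω̄`), which
for a general Jordan domain is neither simply connected in the `ℤ²` sense nor vertex-killed; neither
step is in the cited sources. The lemmas below check the one elementary piece of that passage: the
limit constant `(π/4)(1 + s²)(1 + t²)/(s − t)²` IS the global factor `π/‖e_u − e_v‖²` of Prop. 3.10
evaluated at the Cayley images `e_u = C(s)`, `e_v = C(t)`, `C(z) = (z − i)/(z + i)` (the disc
uniformizer `C ∘ ψ⁻¹` sends the base point `ψ(i)` to `0`), because `‖C(s) − C(t)‖² =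
4(s − t)²/((1 + s²)(1 + t²))` for real `s, t`.
-/

/-- For real `s`, the Cayley denominator `s + i` is nonzero (its imaginary part is `1`). [folklore] -/
theorem cayley_den_ofReal_ne_zero (s : ℝ) : (s : ℂ) + Complex.I ≠ 0 := by
  intro h
  have := congrArg Complex.im h
  simp at this

/-- `‖s + i‖² = 1 + s²` for real `s`. [folklore] -/
theorem norm_ofReal_add_I_sq (s : ℝ) : ‖(s : ℂ) + Complex.I‖ ^ 2 = 1 + s ^ 2 := by
  rw [Complex.sq_norm, Complex.normSq_apply]
  simp
  ring

/-- The Cayley transform `C(z) = (z − i)/(z + i)` (upper half-plane → unit disc, `i ↦ 0`) maps real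
points to the unit circle: `‖C(s)‖ = 1` for `s ∈ ℝ` (Ahlfors, *Complex Analysis*, Ch. 3 §3).
[folklore] -/
theorem norm_cayley_ofReal (s : ℝ) :
    ‖((s : ℂ) - Complex.I) / ((s : ℂ) + Complex.I)‖ = 1 := by
  have hs := cayley_den_ofReal_ne_zero s
  rw [norm_div, div_eq_one_iff_eq (norm_ne_zero_iff.2 hs)]
  have h1 : ‖(s : ℂ) - Complex.I‖ ^ 2 = ‖(s : ℂ) + Complex.I‖ ^ 2 := by
    rw [norm_ofReal_add_I_sq, Complex.sq_norm, Complex.normSq_apply]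
    simp
    ring
  exact (pow_left_inj₀ (norm_nonneg _) (norm_nonneg _) two_ne_zero).1 h1

/-- **Chord between two Cayley boundary points.** For real `s, t`,
`‖C(s) − C(t)‖² = 4 (s − t)² / ((1 + s²)(1 + t²))`, `C(z) = (z − i)/(z + i)`; equivalently
`1 − cos(θ(s) − θ(t)) = 2 (s − t)²/((1 + s²)(1 + t²))` for `e^{iθ(s)} = C(s)` — the identity quoted in
the docstring of `KozdronLawler2005_greenBoundaryFactorisationLimit`
(`C(s) − C(t) = 2i(s − t)/((s + i)(t + i))`). [folklore] -/
theorem norm_cayley_sub_cayley_sq (s t : ℝ) :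
    ‖((s : ℂ) - Complex.I) / ((s : ℂ) + Complex.I) -
        ((t : ℂ) - Complex.I) / ((t : ℂ) + Complex.I)‖ ^ 2 =
      4 * (s - t) ^ 2 / ((1 + s ^ 2) * (1 + t ^ 2)) := by
  have hs := cayley_den_ofReal_ne_zero s
  have ht := cayley_den_ofReal_ne_zero t
  have key : ((s : ℂ) - Complex.I) / ((s : ℂ) + Complex.I) -
      ((t : ℂ) - Complex.I) / ((t : ℂ) + Complex.I) =
      2 * Complex.I * ((s : ℂ) - t) / (((s : ℂ) + Complex.I) * ((t : ℂ) + Complex.I)) := by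
    rw [div_sub_div _ _ hs ht]
    congr 1
    ring
  rw [key, norm_div, norm_mul, norm_mul, norm_mul, div_pow, mul_pow, mul_pow, mul_pow,
    norm_ofReal_add_I_sq, norm_ofReal_add_I_sq, Complex.norm_I, Complex.norm_two,
    ← Complex.ofReal_sub, Complex.norm_real, Real.norm_eq_abs, sq_abs]
  ring

/-- **The limit constant of `KozdronLawler2005_greenBoundaryFactorisationLimit` is the global factor
of Kozdron–Lawler's Prop. 3.10 at the Cayley images of `s ≠ t`:**
`(π/4)(1 + s²)(1 + t²)/(s − t)² = π/‖C(s) − C(t)‖²` (`= (π/2)/(1 − cos(θ(s) − θ(t)))`), i.e. exactly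
the factor `π · G_A(0,x) G_A(0,y)/‖e_x − e_y‖²` of `KozdronLawler_greenFunctionBoundary` divided by the
two local parts, with `e_x = C(s)`, `e_y = C(t)`. Elementary (Cayley algebra); the analytic passage from
Prop. 3.10 to the limit statement is NOT proved here (see the section docstring).
[cite: KozdronLawler2005, Prop. 3.10] -/
theorem greenBoundaryFactorisationLimit_const_eq_pi_div_chord_sq (s t : ℝ) (hst : s ≠ t) :
    Real.pi / 4 * ((1 + s ^ 2) * (1 + t ^ 2)) / (s - t) ^ 2 =
      Real.pi / ‖((s : ℂ) - Complex.I) / ((s : ℂ) + Complex.I) -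
        ((t : ℂ) - Complex.I) / ((t : ℂ) + Complex.I)‖ ^ 2 := by
  rw [norm_cayley_sub_cayley_sq]
  have h1 : (s - t) ^ 2 ≠ 0 := pow_ne_zero 2 (sub_ne_zero.2 hst)
  have h2 : (1 + s ^ 2) * (1 + t ^ 2) ≠ 0 := by positivity
  field_simp

end Literature.Probability.LatticeModels
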